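import Summits.AnomalousDissipation.AnomalousDissipation.Theorems.SolenoidalFractalHomogenisationLagrangianStepLedgerSplitSlop
import HarnessLib

/-!
# K1L_D (stmt-AnomalousDissipation-27980), S23‴ `stub_windowDefectH`: the TRANSFER LEDGER — the energy comparison from per-window
# OPERATOR facts (helper; `--supports … --as helper`; lead-k1l-onelevel-p1 g3)

Abstract Hilbert space `V`; `T k`, `U k` linear contractions (the coarse and the true window maps; `0` beyond the last window); an orthogonal
three-way splitting `P + Q₁ + Q₂ = 1` of `V` (labels `≤ Lc/2` / `(Lc/2, Lg]` / `> Lg`, abstractly); the true chain `u (k+1) = U k (u k)` and the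
coarse chain `v (k+1) = T k (v k)` from the same start `x` with `Q₂ x = 0`.  PER-WINDOW FACTS (p4 g12 L4c §3.2–3.4, operator form, with one
small parameter `ηm` and one super-small slop `ε`):
* (Z) the LOW-LABEL part of the window error is dissipation-dominated: `|⟪y, P (U k − T k) u_k⟫| ≤ ηm √𝔇_k √𝔇*_k(y) + ε‖x‖‖y‖`;
* (Hi) the coarse map neither transmits nor produces nor (adjointly) transmits high labels: `‖T k (Q y)‖, ‖Q (T k y)‖, ‖(T k)† (Q y)‖ ≤ ε‖y‖`;
* (Rec) the high-label transfer bounds of the true map on the chain state (`z = P u_k`, `h₁ = Q₁ u_k`, `h₂ = Q₂ u_k`): outputs of `z` into `Q₁, Q₂`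
  are `≤ √(ηm 𝔇_k) + ε‖x‖` (climbs and reset deposits, dissipation-weighted), `h₁` contracts by `ηm` into both, `h₂` feeds `Q₁` by `ηm` and
  contracts by `1/2` into `Q₂`.
CONCLUSION (uniform in `K`): `‖u K‖² ≤ ‖v K‖² + 1800 ηm (‖x‖² − ‖v K‖²) + 5000 (K+1) ε ‖x‖²` (`ηm ≤ 1/3600`, `ε ≤ 1`).
Proof: `e k := P (U k − T k) u_k`, `f k := Q (U k − T k) u_k` in `window_ledger_split_slop`; the f-budget from the two-class geometric recursion.
Pure Hilbert-space algebra.  Infrastructure for rung F-D1.A0; NOT a proof of the crux or of anomalous dissipation.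
-/

set_option linter.dupNamespace false

namespace Summit.AnomalousDissipation.AnomalousDissipation.Theorems.SolenoidalFractalHomogenisation.LagrangianStep

open scoped InnerProductSpace
open ContinuousLinearMap

noncomputable section

/-! ## The squared geometric recursion in `ℓ²` form -/

/-- If `c (k+1) ≤ (3/4) c k + g k` for `k ≥ 1` with `c ≥ 0`, then `Σ_{k<K} c (k+1)² + 3 c K² ≤ 4 c 1² + 16 Σ_{k<K} g k²` for `K ≥ 1`. -/
theorem sq_sum_recursion_aux (c g : ℕ → ℝ) (hc : ∀ k, 0 ≤ c k)
    (hstep : ∀ k, 1 ≤ k → c (k + 1) ≤ 3 / 4 * c k + g k) :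
    ∀ K, 1 ≤ K → ∑ k ∈ Finset.range K, c (k + 1) ^ 2 + 3 * c K ^ 2 ≤ 4 * c 1 ^ 2 + 16 * ∑ k ∈ Finset.range K, g k ^ 2 := by
  intro K hK
  induction K with
  | zero => exact absurd hK (by omega)
  | succ K ih =>
    rcases Nat.eq_zero_or_pos K with hK0 | hKpos
    · subst hK0
      simp only [zero_add, Finset.range_one, Finset.sum_singleton]
      nlinarith [sq_nonneg (g 0), hc 1]
    · have ih' := ih hKpos
      rw [Finset.sum_range_succ, Finset.sum_range_succ]
      -- `c (K+1)² ≤ (3/4) c K² + 4 g K²`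
      have hs := hstep K hKpos
      have hsq : c (K + 1) ^ 2 ≤ 3 / 4 * c K ^ 2 + 4 * g K ^ 2 := by
        have h1 : c (K + 1) ^ 2 ≤ (3 / 4 * c K + g K) ^ 2 := pow_le_pow_left₀ (hc _) hs 2
        nlinarith [sq_nonneg (1 / 2 * c K - 2 * g K)]
      linarith

/-- `ℓ²` form of the geometric recursion: `Σ_{k<K} c (k+1)² ≤ 4 c 1² + 16 Σ_{k<K} g k²` (all `K`). -/
theorem sq_sum_recursion_le (c g : ℕ → ℝ) (hc : ∀ k, 0 ≤ c k)
    (hstep : ∀ k, 1 ≤ k → c (k + 1) ≤ 3 / 4 * c k + g k) (K : ℕ) :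
    ∑ k ∈ Finset.range K, c (k + 1) ^ 2 ≤ 4 * c 1 ^ 2 + 16 * ∑ k ∈ Finset.range K, g k ^ 2 := by
  rcases Nat.eq_zero_or_pos K with hK0 | hKpos
  · subst hK0; simp only [Finset.range_zero, Finset.sum_empty, mul_zero, add_zero]; positivity
  · have h := sq_sum_recursion_aux c g hc hstep K hKpos
    nlinarith [sq_nonneg (c K)]

/-! ## The transfer ledger -/

variable {V : Type*} [NormedAddCommGroup V] [InnerProductSpace ℝ V] [CompleteSpace V]

omit [CompleteSpace V] in
/-- A contraction chain is bounded by its start. -/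
theorem norm_chain_le_start (U : ℕ → V →L[ℝ] V) (hU : ∀ k y, ‖U k y‖ ≤ ‖y‖) (u : ℕ → V) (hus : ∀ k, u (k + 1) = U k (u k))
    (k : ℕ) : ‖u k‖ ≤ ‖u 0‖ := by
  induction k with
  | zero => exact le_rfl
  | succ k ih => rw [hus k]; exact (hU k _).trans ih

set_option maxHeartbeats 400000 in
/-- **THE TRANSFER LEDGER.**  See the module docstring: per-window operator facts (Z), (Hi), (Rec) for the true/coarse window maps on an
orthogonal three-way label splitting imply the trimmed energy comparison `‖u K‖² ≤ ‖v K‖² + 1800 ηm·(‖x‖² − ‖v K‖²) + 5000 (K+1) ε ‖x‖²`. -/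
theorem transfer_ledger (T U : ℕ → V →L[ℝ] V) (P Q₁ Q₂ : V →L[ℝ] V) (x : V) (u v : ℕ → V) (ηm ε : ℝ)
    (hT : ∀ k y, ‖T k y‖ ≤ ‖y‖) (hU : ∀ k y, ‖U k y‖ ≤ ‖y‖)
    (hPQ : ∀ y, P y + Q₁ y + Q₂ y = y) (hpyth : ∀ y, ‖y‖ ^ 2 = ‖P y‖ ^ 2 + ‖Q₁ y‖ ^ 2 + ‖Q₂ y‖ ^ 2)
    (horth : ∀ y y', ⟪P y, Q₁ y' + Q₂ y'⟫_ℝ = 0) (hQx : Q₂ x = 0)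
    (hηm0 : 0 ≤ ηm) (hηm : ηm ≤ 1 / 3600) (hε0 : 0 ≤ ε) (hε1 : ε ≤ 1)
    (hu0 : u 0 = x) (hus : ∀ k, u (k + 1) = U k (u k)) (hv0 : v 0 = x) (hvs : ∀ k, v (k + 1) = T k (v k))
    (hZ : ∀ k, ∀ y : V, |⟪y, P (U k (u k) - T k (u k))⟫_ℝ| ≤
      ηm * Real.sqrt (‖u k‖ ^ 2 - ‖T k (u k)‖ ^ 2) * Real.sqrt (‖y‖ ^ 2 - ‖adjoint (T k) y‖ ^ 2) + ε * ‖x‖ * ‖y‖)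
    (hHi : ∀ k, ∀ y : V, ‖T k (Q₁ y + Q₂ y)‖ ≤ ε * ‖y‖ ∧ ‖Q₁ (T k y) + Q₂ (T k y)‖ ≤ ε * ‖y‖ ∧
      ‖adjoint (T k) (Q₁ y + Q₂ y)‖ ≤ ε * ‖y‖)
    (hR1 : ∀ k, ‖Q₁ (U k (P (u k)))‖ ≤ Real.sqrt (ηm * (‖u k‖ ^ 2 - ‖T k (u k)‖ ^ 2)) + ε * ‖x‖)
    (hR2 : ∀ k, ‖Q₂ (U k (P (u k)))‖ ≤ Real.sqrt (ηm * (‖u k‖ ^ 2 - ‖T k (u k)‖ ^ 2)) + ε * ‖x‖)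
    (hR3 : ∀ k, ‖Q₁ (U k (Q₁ (u k)))‖ ≤ ηm * ‖Q₁ (u k)‖ + ε * ‖x‖)
    (hR4 : ∀ k, ‖Q₂ (U k (Q₁ (u k)))‖ ≤ ηm * ‖Q₁ (u k)‖ + ε * ‖x‖)
    (hR5 : ∀ k, ‖Q₁ (U k (Q₂ (u k)))‖ ≤ ηm * ‖Q₂ (u k)‖ + ε * ‖x‖)
    (hR6 : ∀ k, ‖Q₂ (U k (Q₂ (u k)))‖ ≤ 1 / 2 * ‖Q₂ (u k)‖ + ε * ‖x‖)
    (K : ℕ) :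
    ‖u K‖ ^ 2 ≤ ‖v K‖ ^ 2 + 1800 * ηm * (‖x‖ ^ 2 - ‖v K‖ ^ 2) + 5000 * ((K : ℝ) + 1) * ε * ‖x‖ ^ 2 := by
  -- notation
  have hx0 : 0 ≤ ‖x‖ := norm_nonneg _
  have huB : ∀ k, ‖u k‖ ≤ ‖x‖ := fun k => hu0 ▸ norm_chain_le_start U hU u hus k
  have hD0 : ∀ k, 0 ≤ ‖u k‖ ^ 2 - ‖T k (u k)‖ ^ 2 := fun k => dissip_nonneg (hT k) (u k)
  have hDle : ∀ k, ‖u k‖ ^ 2 - ‖T k (u k)‖ ^ 2 ≤ ‖x‖ ^ 2 := fun k => by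
    nlinarith [huB k, norm_nonneg (T k (u k)), norm_nonneg (u k)]
  -- the window errors, split by OUTPUT label
  set e : ℕ → V := fun k => P (U k (u k) - T k (u k)) with he_def
  set f : ℕ → V := fun k => Q₁ (U k (u k) - T k (u k)) + Q₂ (U k (u k) - T k (u k)) with hf_def
  have hu : ∀ k, u (k + 1) = T k (u k) + e k + f k := by
    intro k
    show u (k + 1) = T k (u k) + P (U k (u k) - T k (u k)) + (Q₁ (U k (u k) - T k (u k)) + Q₂ (U k (u k) - T k (u k)))
    rw [hus k]
    have h := hPQ (U k (u k) - T k (u k))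
    calc U k (u k) = T k (u k) + (U k (u k) - T k (u k)) := by abel
      _ = T k (u k) + (P (U k (u k) - T k (u k)) + Q₁ (U k (u k) - T k (u k)) + Q₂ (U k (u k) - T k (u k))) := by rw [h]
      _ = _ := by abel
  -- (DD) with slop for `e`
  have hDD : ∀ k, ∀ y : V, |⟪y, e k⟫_ℝ| ≤
      ηm * Real.sqrt (‖u k‖ ^ 2 - ‖T k (u k)‖ ^ 2) * Real.sqrt (‖y‖ ^ 2 - ‖adjoint (T k) y‖ ^ 2) + (ε * ‖x‖) * ‖y‖ := by
    intro k y; rw [he_def]; exact hZ k y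
  -- the f-terms: energy, coarse-invisibility, orthogonality to `e`
  have herr_le : ∀ k, ‖U k (u k) - T k (u k)‖ ≤ 2 * ‖x‖ := fun k => by
    calc ‖U k (u k) - T k (u k)‖ ≤ ‖U k (u k)‖ + ‖T k (u k)‖ := norm_sub_le _ _
      _ ≤ ‖u k‖ + ‖u k‖ := add_le_add (hU k _) (hT k _)
      _ ≤ 2 * ‖x‖ := by linarith [huB k]
  have hF2 : ∀ k, ‖T (k + 1) (f k)‖ ≤ 2 * ε * ‖x‖ := fun k => by
    rw [hf_def]
    calc ‖T (k + 1) (Q₁ (U k (u k) - T k (u k)) + Q₂ (U k (u k) - T k (u k)))‖ ≤ ε * ‖U k (u k) - T k (u k)‖ := (hHi (k + 1) _).1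
      _ ≤ ε * (2 * ‖x‖) := mul_le_mul_of_nonneg_left (herr_le k) hε0
      _ = 2 * ε * ‖x‖ := by ring
  have hF3 : ∀ k, ‖adjoint (T k) (f k)‖ ≤ 2 * ε * ‖x‖ := fun k => by
    rw [hf_def]
    calc ‖adjoint (T k) (Q₁ (U k (u k) - T k (u k)) + Q₂ (U k (u k) - T k (u k)))‖ ≤ ε * ‖U k (u k) - T k (u k)‖ := (hHi k _).2.2
      _ ≤ ε * (2 * ‖x‖) := mul_le_mul_of_nonneg_left (herr_le k) hε0
      _ = 2 * ε * ‖x‖ := by ring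
  have hF4 : ∀ k, |⟪e k, f k⟫_ℝ| ≤ 0 := fun k => by
    rw [he_def, hf_def]; simp only; rw [horth, abs_zero]
  -- the two-class recursion: `c k := ‖Q₁ (u k)‖ + ‖Q₂ (u k)‖`
  set c : ℕ → ℝ := fun k => ‖Q₁ (u k)‖ + ‖Q₂ (u k)‖ with hc_def
  set g : ℕ → ℝ := fun k => 2 * Real.sqrt (ηm * (‖u k‖ ^ 2 - ‖T k (u k)‖ ^ 2)) + 6 * (ε * ‖x‖) with hg_def
  have hc0 : ∀ k, 0 ≤ c k := fun k => by rw [hc_def]; positivity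
  have hsplit_u : ∀ k, U k (u k) = U k (P (u k)) + U k (Q₁ (u k)) + U k (Q₂ (u k)) := fun k => by
    rw [← map_add, ← map_add, hPQ]
  have ha_step : ∀ k, ‖Q₁ (u (k + 1))‖ ≤ ηm * (‖Q₁ (u k)‖ + ‖Q₂ (u k)‖)
      + Real.sqrt (ηm * (‖u k‖ ^ 2 - ‖T k (u k)‖ ^ 2)) + 3 * (ε * ‖x‖) := fun k => by
    rw [hus k, hsplit_u k, map_add, map_add]
    calc ‖Q₁ (U k (P (u k))) + Q₁ (U k (Q₁ (u k))) + Q₁ (U k (Q₂ (u k)))‖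
        ≤ ‖Q₁ (U k (P (u k)))‖ + ‖Q₁ (U k (Q₁ (u k)))‖ + ‖Q₁ (U k (Q₂ (u k)))‖ := norm_add₃_le
      _ ≤ _ := by linarith [hR1 k, hR3 k, hR5 k]
  have hb_step : ∀ k, ‖Q₂ (u (k + 1))‖ ≤ ηm * ‖Q₁ (u k)‖ + 1 / 2 * ‖Q₂ (u k)‖
      + Real.sqrt (ηm * (‖u k‖ ^ 2 - ‖T k (u k)‖ ^ 2)) + 3 * (ε * ‖x‖) := fun k => by
    rw [hus k, hsplit_u k, map_add, map_add]
    calc ‖Q₂ (U k (P (u k))) + Q₂ (U k (Q₁ (u k))) + Q₂ (U k (Q₂ (u k)))‖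
        ≤ ‖Q₂ (U k (P (u k)))‖ + ‖Q₂ (U k (Q₁ (u k)))‖ + ‖Q₂ (U k (Q₂ (u k)))‖ := norm_add₃_le
      _ ≤ _ := by linarith [hR2 k, hR4 k, hR6 k]
  have hc_step : ∀ k, 1 ≤ k → c (k + 1) ≤ 3 / 4 * c k + g k := fun k _ => by
    have h1 := ha_step k; have h2 := hb_step k
    have hQ1 : 0 ≤ ‖Q₁ (u k)‖ := norm_nonneg _
    have hQ2 : 0 ≤ ‖Q₂ (u k)‖ := norm_nonneg _
    show ‖Q₁ (u (k + 1))‖ + ‖Q₂ (u (k + 1))‖ ≤ 3 / 4 * (‖Q₁ (u k)‖ + ‖Q₂ (u k)‖)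
      + (2 * Real.sqrt (ηm * (‖u k‖ ^ 2 - ‖T k (u k)‖ ^ 2)) + 6 * (ε * ‖x‖))
    nlinarith
  -- the first step sharp: `c 1 ≤ 2 ηm ‖Q₁ x‖ + g 0` (uses `Q₂ x = 0`)
  have hc1 : c 1 ≤ 2 * ηm * ‖Q₁ x‖ + g 0 := by
    have h1 := ha_step 0; have h2 := hb_step 0
    rw [hu0, hQx, norm_zero] at h1 h2
    show ‖Q₁ (u (0 + 1))‖ + ‖Q₂ (u (0 + 1))‖ ≤ 2 * ηm * ‖Q₁ x‖
      + (2 * Real.sqrt (ηm * (‖u 0‖ ^ 2 - ‖T 0 (u 0)‖ ^ 2)) + 6 * (ε * ‖x‖))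
    rw [hu0]
    linarith
  -- `‖Q₁ x‖² ≤ 𝔇_0 + 3 ε ‖x‖²`
  have hQ1x : ‖Q₁ x‖ ^ 2 ≤ (‖u 0‖ ^ 2 - ‖T 0 (u 0)‖ ^ 2) + 3 * ε * ‖x‖ ^ 2 := by
    rw [hu0]
    have hTx : ‖T 0 x‖ ≤ ‖P x‖ + ε * ‖x‖ := by
      have e1 : T 0 x = T 0 (P x) + T 0 (Q₁ x + Q₂ x) := by rw [← map_add, ← add_assoc, hPQ]
      rw [e1]
      calc ‖T 0 (P x) + T 0 (Q₁ x + Q₂ x)‖ ≤ ‖T 0 (P x)‖ + ‖T 0 (Q₁ x + Q₂ x)‖ := norm_add_le _ _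
        _ ≤ ‖P x‖ + ε * ‖x‖ := add_le_add (hT 0 _) (hHi 0 x).1
    have hPx : ‖P x‖ ≤ ‖x‖ := by
      have h2 : ‖P x‖ ^ 2 ≤ ‖x‖ ^ 2 := by nlinarith [hpyth x, sq_nonneg ‖Q₁ x‖, sq_nonneg ‖Q₂ x‖]
      calc ‖P x‖ = Real.sqrt (‖P x‖ ^ 2) := (Real.sqrt_sq (norm_nonneg _)).symm
        _ ≤ Real.sqrt (‖x‖ ^ 2) := Real.sqrt_le_sqrt h2
        _ = ‖x‖ := Real.sqrt_sq (norm_nonneg _)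
    have hTx2 : ‖T 0 x‖ ^ 2 ≤ ‖P x‖ ^ 2 + 3 * ε * ‖x‖ ^ 2 := by
      have h1 := pow_le_pow_left₀ (norm_nonneg _) hTx 2
      have c1 : ε * ‖x‖ * ‖P x‖ ≤ ε * ‖x‖ * ‖x‖ := mul_le_mul_of_nonneg_left hPx (mul_nonneg hε0 hx0)
      have hε2 : ε ^ 2 ≤ ε := by nlinarith
      have c2 : ε ^ 2 * ‖x‖ ^ 2 ≤ ε * ‖x‖ ^ 2 := mul_le_mul_of_nonneg_right hε2 (sq_nonneg _)
      linarith [h1, c1, c2]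
    nlinarith [hpyth x, norm_nonneg (Q₂ x)]
  -- the f-budget
  have hF_le : ∀ k, ‖f k‖ ≤ c (k + 1) + ε * ‖x‖ := fun k => by
    have e1 : f k = (Q₁ (u (k + 1)) + Q₂ (u (k + 1))) - (Q₁ (T k (u k)) + Q₂ (T k (u k))) := by
      rw [hf_def, hus k]; simp only [map_sub]; abel
    rw [e1]
    calc ‖(Q₁ (u (k + 1)) + Q₂ (u (k + 1))) - (Q₁ (T k (u k)) + Q₂ (T k (u k)))‖
        ≤ ‖Q₁ (u (k + 1)) + Q₂ (u (k + 1))‖ + ‖Q₁ (T k (u k)) + Q₂ (T k (u k))‖ := norm_sub_le _ _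
      _ ≤ (‖Q₁ (u (k + 1))‖ + ‖Q₂ (u (k + 1))‖) + ε * ‖u k‖ := add_le_add (norm_add_le _ _) (hHi k (u k)).2.1
      _ ≤ c (k + 1) + ε * ‖x‖ := by
          show _ ≤ (‖Q₁ (u (k + 1))‖ + ‖Q₂ (u (k + 1))‖) + ε * ‖x‖
          have := mul_le_mul_of_nonneg_left (huB k) hε0; linarith
  have hg_sq : ∀ k, g k ^ 2 ≤ 8 * ηm * (‖u k‖ ^ 2 - ‖T k (u k)‖ ^ 2) + 72 * (ε * ‖x‖) ^ 2 := fun k => by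
    rw [hg_def]; simp only
    have hs : Real.sqrt (ηm * (‖u k‖ ^ 2 - ‖T k (u k)‖ ^ 2)) ^ 2 = ηm * (‖u k‖ ^ 2 - ‖T k (u k)‖ ^ 2) :=
      Real.sq_sqrt (mul_nonneg hηm0 (hD0 k))
    nlinarith [sq_nonneg (Real.sqrt (ηm * (‖u k‖ ^ 2 - ‖T k (u k)‖ ^ 2)) - 3 * (ε * ‖x‖)), Real.sqrt_nonneg (ηm * (‖u k‖ ^ 2 - ‖T k (u k)‖ ^ 2)),
      mul_nonneg hε0 hx0]
  have hbudget : ∀ K, ∑ k ∈ Finset.range K, (‖f k‖ ^ 2 + 2 * 0)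
      ≤ 448 * ηm * ∑ k ∈ Finset.range K, (‖u k‖ ^ 2 - ‖T k (u k)‖ ^ 2) + 2400 * ((K : ℝ) + 1) * ε * ‖x‖ ^ 2 := by
    intro K
    have hrec := sq_sum_recursion_le c g hc0 hc_step K
    have h1 : ∑ k ∈ Finset.range K, (‖f k‖ ^ 2 + 2 * 0) ≤ ∑ k ∈ Finset.range K, (2 * c (k + 1) ^ 2 + 2 * (ε * ‖x‖) ^ 2) :=
      Finset.sum_le_sum fun k _ => by
        have h := pow_le_pow_left₀ (norm_nonneg _) (hF_le k) 2
        nlinarith [sq_nonneg (c (k + 1) - ε * ‖x‖)]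
    have h2 : ∑ k ∈ Finset.range K, (2 * c (k + 1) ^ 2 + 2 * (ε * ‖x‖) ^ 2)
        = 2 * ∑ k ∈ Finset.range K, c (k + 1) ^ 2 + 2 * (K : ℝ) * (ε * ‖x‖) ^ 2 := by
      rw [Finset.sum_add_distrib, Finset.sum_const, Finset.card_range, ← Finset.mul_sum]; simp; ring
    have h3 : ∑ k ∈ Finset.range K, g k ^ 2 ≤ 8 * ηm * ∑ k ∈ Finset.range K, (‖u k‖ ^ 2 - ‖T k (u k)‖ ^ 2)
        + 72 * (K : ℝ) * (ε * ‖x‖) ^ 2 := by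
      calc ∑ k ∈ Finset.range K, g k ^ 2 ≤ ∑ k ∈ Finset.range K, (8 * ηm * (‖u k‖ ^ 2 - ‖T k (u k)‖ ^ 2) + 72 * (ε * ‖x‖) ^ 2) :=
            Finset.sum_le_sum fun k _ => hg_sq k
        _ = _ := by rw [Finset.sum_add_distrib, Finset.sum_const, Finset.card_range, ← Finset.mul_sum]; simp; ring
    have hc1sq : c 1 ^ 2 ≤ 8 * ηm ^ 2 * ‖Q₁ x‖ ^ 2 + 2 * g 0 ^ 2 := by
      have h := pow_le_pow_left₀ (hc0 1) hc1 2
      nlinarith [sq_nonneg (2 * ηm * ‖Q₁ x‖ - g 0)]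
    have hg0sq := hg_sq 0
    have hS : 0 ≤ ∑ k ∈ Finset.range K, (‖u k‖ ^ 2 - ‖T k (u k)‖ ^ 2) := Finset.sum_nonneg fun k _ => hD0 k
    have hεx : 0 ≤ ε * ‖x‖ := mul_nonneg hε0 hx0
    have hε2 : ε ^ 2 ≤ ε := by nlinarith
    have hεx2 : (ε * ‖x‖) ^ 2 ≤ ε * ‖x‖ ^ 2 := by rw [mul_pow]; exact mul_le_mul_of_nonneg_right hε2 (sq_nonneg _)
    have hK0 : (0 : ℝ) ≤ K := Nat.cast_nonneg K
    rcases Nat.eq_zero_or_pos K with hK | hK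
    · subst hK; simp; positivity
    · -- `𝔇_0 ≤ Σ_{k<K} 𝔇_k`
      have hD0le : ‖u 0‖ ^ 2 - ‖T 0 (u 0)‖ ^ 2 ≤ ∑ k ∈ Finset.range K, (‖u k‖ ^ 2 - ‖T k (u k)‖ ^ 2) :=
        Finset.single_le_sum (f := fun k => ‖u k‖ ^ 2 - ‖T k (u k)‖ ^ 2) (fun k _ => hD0 k) (Finset.mem_range.2 hK)
      have hηm2 : ηm ^ 2 ≤ ηm := by nlinarith
      have hQ1x' : ηm ^ 2 * ‖Q₁ x‖ ^ 2 ≤ ηm * (∑ k ∈ Finset.range K, (‖u k‖ ^ 2 - ‖T k (u k)‖ ^ 2)) + 3 * ε * ‖x‖ ^ 2 := by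
        have a1 : ηm ^ 2 * ‖Q₁ x‖ ^ 2 ≤ ηm ^ 2 * ((‖u 0‖ ^ 2 - ‖T 0 (u 0)‖ ^ 2) + 3 * ε * ‖x‖ ^ 2) :=
          mul_le_mul_of_nonneg_left hQ1x (sq_nonneg _)
        have a2 : ηm ^ 2 * (‖u 0‖ ^ 2 - ‖T 0 (u 0)‖ ^ 2) ≤ ηm * ∑ k ∈ Finset.range K, (‖u k‖ ^ 2 - ‖T k (u k)‖ ^ 2) :=
          mul_le_mul hηm2 hD0le (hD0 0) hηm0
        have a3 : ηm ^ 2 * (3 * ε * ‖x‖ ^ 2) ≤ 1 * (3 * ε * ‖x‖ ^ 2) :=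
          mul_le_mul_of_nonneg_right (by nlinarith) (by positivity)
        nlinarith
      have a4 : ηm * (‖u 0‖ ^ 2 - ‖T 0 (u 0)‖ ^ 2) ≤ ηm * ∑ k ∈ Finset.range K, (‖u k‖ ^ 2 - ‖T k (u k)‖ ^ 2) :=
        mul_le_mul_of_nonneg_left hD0le hηm0
      have a5 : (K : ℝ) * (ε * ‖x‖) ^ 2 ≤ (K : ℝ) * (ε * ‖x‖ ^ 2) := mul_le_mul_of_nonneg_left hεx2 hK0
      have a6 : 0 ≤ ε * ‖x‖ ^ 2 := by positivity
      have a7 : 0 ≤ (K : ℝ) * (ε * ‖x‖ ^ 2) := by positivity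
      linarith [hrec, h1, h2, h3, hc1sq, hg0sq, hQ1x', a4, a5, a6, a7, hεx2]
  -- apply the ledger with slop
  have hL := window_ledger_split_slop T hT u v e f ηm (448 * ηm) (2400 * ((K : ℝ) + 1) * ε * ‖x‖ ^ 2)
    (fun k => ‖f k‖ ^ 2) (fun _ => 0) (fun _ => 2 * ε * ‖x‖) (fun _ => ε * ‖x‖)
    hηm0 (by linarith) (by positivity) (by linarith) (by positivity) (fun _ => by positivity) (fun _ => by positivity)
    (by rw [hu0, hv0]) hvs hu (fun k => by rw [hu0]; exact huB k) hDD (fun _ => le_rfl) hF2 hF3 hF4 K (hbudget K)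
  have hv0' : ‖v 0‖ = ‖x‖ := by rw [hv0]
  rw [hv0'] at hL
  simp only [Finset.sum_const, Finset.card_range, nsmul_eq_mul] at hL
  have hK0 : (0 : ℝ) ≤ K := Nat.cast_nonneg K
  have hεx : 0 ≤ ε * ‖x‖ := mul_nonneg hε0 hx0
  have hvK : ‖v K‖ ≤ ‖x‖ := hv0 ▸ norm_exact_le T hT v hvs K
  have hdrop : 0 ≤ ‖x‖ ^ 2 - ‖v K‖ ^ 2 := by nlinarith [norm_nonneg (v K)]
  have hε2 : ε ^ 2 ≤ ε := by nlinarith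
  have b1 : (K : ℝ) * (ε * ‖x‖) ^ 2 ≤ (K : ℝ) * (ε * ‖x‖ ^ 2) :=
    mul_le_mul_of_nonneg_left (by rw [mul_pow]; exact mul_le_mul_of_nonneg_right hε2 (sq_nonneg _)) hK0
  have b2 : 0 ≤ ηm * (‖x‖ ^ 2 - ‖v K‖ ^ 2) := mul_nonneg hηm0 hdrop
  have b3 : 0 ≤ (K : ℝ) * (ε * ‖x‖ ^ 2) := by positivity
  have b4 : 0 ≤ ε * ‖x‖ ^ 2 := by positivity
  linarith [hL, b1, b2, b3, b4]

end

end Summit.AnomalousDissipation.AnomalousDissipation.Theorems.SolenoidalFractalHomogenisation.LagrangianStep
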